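import Mathlib
import Literature.Analysis.FluidPDE.CKNPressureHessianSlice
import Literature.Analysis.FunctionSpaces.SobolevDifferenceQuotients
import Summits.NavierStokesRegularity.NavierStokesRegularity.Theorems.EulerZoomLiouvillePowerGaugeEulerLiouvillePastFrameSteadyConfined
import Summits.NavierStokesRegularity.NavierStokesRegularity.Theorems.EulerZoomLiouvillePowerGaugeEulerLiouvilleRotatingFrameSteady
import HarnessLib

/-!
# RIGID-FRAME-STEADY PAST MEMBERS WITH A SUB-CRITICALLY CONFINED CENTRE ARE TRIVIAL — the full `E(3)`-steady stratum
# (crux `EulerZoomLiouville.PowerGaugeEulerLiouville` = stmt-NavierStokesRegularity-19832; line `galilean_frames` symmetry strata; width seat ns-ezl-w3 g5)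

Route №10 `EulerZoomLiouville` (NavierStokesRegularity), crux E.  Common generalisation of F1c `FrameSteady.ae_eq_zero_of_gauge_of_pastFrameSteady_confined`
(ns-ezl-w6 g2; `R ≡ id`) and F1-rot `RotatingFrame.ae_eq_zero_of_gauge_of_pastRotatingFrameSteady` (this seat; `ξ ≡ 0`): a member `(u, p, H)` of Seregin's
power-gauged class that is STEADY MODULO A RIGID MOTION below some `T₁ ≤ 0` —

> `u(τ, y) = R(τ) U(R(τ)⁻¹ (y − ξ(τ))) + η(τ)` for `τ < T₁`, `R : ℝ → O(3)` an arbitrary path of linear isometries, `ξ` a centre path with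
> `‖ξ(τ)‖ ≤ K(1+|τ|)^β`, `β(1−ρ) < 1`, `η` a background, `U` an arbitrary profile —

VANISHES a.e. on the slab (`RigidFrame.ae_eq_zero_of_gauge_of_pastRigidFrameSteady_confined`).  ROUTE = F1c's with the rotation inserted:
(1) one profile gradient carries every slice, `H(τ) = R(τ) G₀(R(τ)⁻¹(· − ξ(τ))) R(τ)⁻¹` a.e. (`RigidFrame.exists_profileGradient_rigid`: translate —
`HasWeakFDerivOn.comp_add`, rotate — `RotatingFrame.hasWeakFDerivOn_comp_isometry`, translate, conjugate — `HasWeakFDerivOn.clm_comp`, uniqueness);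
(2) packing on windows where the centre stays in `B_{a/2}` (`RigidFrame.window_mul_le_of_gaugeE_rigid`: `L ∫_{B_{a/2}}‖G₀‖² ≤ c a^{1−ρ}`, the ball rotated by
`RotatingFrame.setLIntegral_ball_comp_isometry` and translated by `FrameSteady.setLIntegral_ball_half_le_translate`, `‖M‖ ≤ ‖RMR⁻¹‖ ≤ |RMR⁻¹|_F`);
(3) `G₀ = 0` under sub-critical escape (`RigidFrame.setLIntegral_profileGradient_rigid_eq_zero`, F1c's windows `a = (2K+1)(1+L+|T₁|)^{max β 1}` verbatim);
(4) `H = 0` a.e. below `T₁` ⇒ slices a.e. constant with zero energy ⇒ the member vanishes (tree lemmas, verbatim as in F1c / F1-rot).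

WHAT THIS IS NOT: not NS regularity, not the crux E — the `E(3)`-steady symmetry stratum of the crux CLASS 19832 (MODEL lattice; E/NS strata),
`--supports` stmt-19832; 19832 OPEN. [folklore]
-/

noncomputable section

-- flat `Theorems/<Route><Decl>…` files of one crux share the namespace of the crux (tree convention: `Summit.<S>.<S>.…`)
set_option linter.dupNamespace false

open MeasureTheory Set Filter Topology Metric Function TopologicalSpace
open scoped ENNReal NNReal

namespace Summit.NavierStokesRegularity.NavierStokesRegularity.Theorems.PowerGaugeEulerLiouville

open Literature.Analysis Literature.Analysis.FunctionSpaces Literature.Analysis.FluidPDE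

namespace RigidFrame

variable {u : ℝ → EuclideanSpace ℝ (Fin 3) → EuclideanSpace ℝ (Fin 3)}
  {H : ℝ → EuclideanSpace ℝ (Fin 3) → EuclideanSpace ℝ (Fin 3) →L[ℝ] EuclideanSpace ℝ (Fin 3)}
  {T₁ : ℝ} {U : EuclideanSpace ℝ (Fin 3) → EuclideanSpace ℝ (Fin 3)}
  {R : ℝ → EuclideanSpace ℝ (Fin 3) ≃ₗᵢ[ℝ] EuclideanSpace ℝ (Fin 3)} {ξ η : ℝ → EuclideanSpace ℝ (Fin 3)}

/-! ## (1) One profile gradient carries every slice -/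

/-- **ONE FIELD CARRIES EVERY SLICE (rigid frame).**  If `u(τ, ·) = R(τ) U(R(τ)⁻¹(· − ξ(τ))) + η(τ)` for `τ < T₁ ≤ 0` and `H` is a weak spatial gradient
of `u` on the slab, there is an a.e.-strongly measurable `G₀` with `H(τ, y) = R(τ) ∘ G₀(R(τ)⁻¹ (y − ξ(τ))) ∘ R(τ)⁻¹` a.e., for a.e. `τ < T₁`. [folklore] -/
theorem exists_profileGradient_rigid
    (hH : HasWeakSpatialGradientOn (slab (EuclideanSpace ℝ (Fin 3)) (Iio 0) isOpen_Iio) u H) (hT₁ : T₁ ≤ 0)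
    (hu : ∀ τ : ℝ, τ < T₁ → u τ = fun y => R τ (U ((R τ).symm (y - ξ τ))) + η τ) :
    ∃ G₀ : EuclideanSpace ℝ (Fin 3) → EuclideanSpace ℝ (Fin 3) →L[ℝ] EuclideanSpace ℝ (Fin 3),
      AEStronglyMeasurable G₀ volume ∧
      ∀ᵐ τ ∂(volume.restrict (Iio T₁)), H τ =ᵐ[volume] fun y =>
        (R τ : EuclideanSpace ℝ (Fin 3) →L[ℝ] EuclideanSpace ℝ (Fin 3)).comp
          ((G₀ ((R τ).symm (y - ξ τ))).comp ((R τ).symm : EuclideanSpace ℝ (Fin 3) →L[ℝ] EuclideanSpace ℝ (Fin 3))) := by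
  have hgood := FrameSteady.ae_hasWeakFDerivOn_slice_past hH hT₁
  have hne : (ae (volume.restrict (Iio T₁))).NeBot := by
    rw [ae_neBot, Ne, Measure.restrict_eq_zero, Real.volume_Iio]; exact ENNReal.top_ne_zero
  obtain ⟨τ₀, hτ₀, hτ₀T⟩ := (hgood.and (ae_restrict_mem measurableSet_Iio)).exists
  set G₀ : EuclideanSpace ℝ (Fin 3) → EuclideanSpace ℝ (Fin 3) →L[ℝ] EuclideanSpace ℝ (Fin 3) := fun w =>
    ((R τ₀).symm : EuclideanSpace ℝ (Fin 3) →L[ℝ] EuclideanSpace ℝ (Fin 3)).comp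
      ((H τ₀ (R τ₀ w + ξ τ₀)).comp (R τ₀ : EuclideanSpace ℝ (Fin 3) →L[ℝ] EuclideanSpace ℝ (Fin 3))) with hG₀
  refine ⟨G₀, ?_, ?_⟩
  · have h1 : AEStronglyMeasurable (H τ₀) volume := by
      have := hτ₀.locallyIntegrableOn_deriv.aestronglyMeasurable
      rwa [Opens.coe_top, Measure.restrict_univ] at this
    have h2 : AEStronglyMeasurable (fun w => H τ₀ (R τ₀ w + ξ τ₀)) volume :=
      h1.comp_quasiMeasurePreserving
        ((measurePreserving_add_right volume (ξ τ₀)).comp (R τ₀).measurePreserving).quasiMeasurePreserving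
    have hc : Continuous fun M : EuclideanSpace ℝ (Fin 3) →L[ℝ] EuclideanSpace ℝ (Fin 3) =>
        ((R τ₀).symm : EuclideanSpace ℝ (Fin 3) →L[ℝ] EuclideanSpace ℝ (Fin 3)).comp
          (M.comp (R τ₀ : EuclideanSpace ℝ (Fin 3) →L[ℝ] EuclideanSpace ℝ (Fin 3))) :=
      continuous_const.clm_comp (continuous_id.clm_comp continuous_const)
    exact hc.comp_aestronglyMeasurable h2
  · filter_upwards [hgood, ae_restrict_mem measurableSet_Iio] with τ hτ hτT
    set L : EuclideanSpace ℝ (Fin 3) ≃ₗᵢ[ℝ] EuclideanSpace ℝ (Fin 3) := (R τ).symm.trans (R τ₀) with hL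
    have hLa : ∀ y, L y = R τ₀ ((R τ).symm y) := fun y => rfl
    have hLs : ∀ x, L.symm x = R τ ((R τ₀).symm x) := fun x => rfl
    set κ : EuclideanSpace ℝ (Fin 3) := η τ - R τ ((R τ₀).symm (η τ₀)) with hκ
    have hrel : u τ = fun y =>
        (L.symm : EuclideanSpace ℝ (Fin 3) →L[ℝ] EuclideanSpace ℝ (Fin 3)) (u τ₀ (L (y - ξ τ) + ξ τ₀)) + κ := by
      rw [hu τ hτT]
      funext y
      rw [hu τ₀ hτ₀T]
      simp only [LinearIsometryEquiv.coe_coe'', hLa, hLs, map_add, add_sub_cancel_right, LinearIsometryEquiv.symm_apply_apply, hκ]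
      abel
    -- translate, rotate, translate, conjugate
    have h1 : HasWeakFDerivOn (⊤ : Opens (EuclideanSpace ℝ (Fin 3))) volume (fun y => u τ₀ (y + ξ τ₀)) (fun y => H τ₀ (y + ξ τ₀)) :=
      hτ₀.comp_add volume fun y _ => mem_univ _
    have h2 := RotatingFrame.hasWeakFDerivOn_comp_isometry L h1
    have h3 : HasWeakFDerivOn (⊤ : Opens (EuclideanSpace ℝ (Fin 3))) volume (fun y => u τ₀ (L (y + -ξ τ) + ξ τ₀))
        (fun y => (H τ₀ (L (y + -ξ τ) + ξ τ₀)).comp (L : EuclideanSpace ℝ (Fin 3) →L[ℝ] EuclideanSpace ℝ (Fin 3))) :=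
      h2.comp_add volume fun y _ => mem_univ _
    have h4 := h3.clm_comp (L.symm : EuclideanSpace ℝ (Fin 3) →L[ℝ] EuclideanSpace ℝ (Fin 3))
    have hc : HasWeakFDerivOn (⊤ : Opens (EuclideanSpace ℝ (Fin 3))) volume (fun _ : EuclideanSpace ℝ (Fin 3) => -κ)
        (fderiv ℝ fun _ : EuclideanSpace ℝ (Fin 3) => -κ) :=
      HasWeakFDerivOn.of_contDiff_holds ⊤ volume contDiff_const
    have h5 := h4.sub hc
    have e1 : ((fun y => (L.symm : EuclideanSpace ℝ (Fin 3) →L[ℝ] EuclideanSpace ℝ (Fin 3)) (u τ₀ (L (y + -ξ τ) + ξ τ₀))) -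
        fun _ : EuclideanSpace ℝ (Fin 3) => -κ) = u τ := by
      rw [hrel]; funext y; simp only [Pi.sub_apply, sub_neg_eq_add, ← sub_eq_add_neg]
    have e2 : ((fun y => (L.symm : EuclideanSpace ℝ (Fin 3) →L[ℝ] EuclideanSpace ℝ (Fin 3)).comp
          ((H τ₀ (L (y + -ξ τ) + ξ τ₀)).comp (L : EuclideanSpace ℝ (Fin 3) →L[ℝ] EuclideanSpace ℝ (Fin 3)))) -
        fderiv ℝ fun _ : EuclideanSpace ℝ (Fin 3) => -κ) =
        fun y => (L.symm : EuclideanSpace ℝ (Fin 3) →L[ℝ] EuclideanSpace ℝ (Fin 3)).comp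
          ((H τ₀ (L (y - ξ τ) + ξ τ₀)).comp (L : EuclideanSpace ℝ (Fin 3) →L[ℝ] EuclideanSpace ℝ (Fin 3))) := by
      funext y; simp [← sub_eq_add_neg]
    rw [e1, e2] at h5
    have h6 := HasWeakFDerivOn.unique_holds hτ h5
    rw [Opens.coe_top, Measure.restrict_univ] at h6
    filter_upwards [h6] with y hy
    rw [hy]
    apply ContinuousLinearMap.ext
    intro v
    simp only [hG₀, ContinuousLinearMap.comp_apply, LinearIsometryEquiv.coe_coe'', hLa, hLs]

/-! ## (2) E-gauge packing in continuous time, rigid frame -/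

/-- **THE PACKING BOUND (rigid frame).**  If `H(τ) = R(τ) G₀(R(τ)⁻¹(· − ξ(τ))) R(τ)⁻¹` a.e. for a.e. `τ < T₁ ≤ 0`, the centre stays in `B_{a/2}` on the window
`(T₁ − L, T₁)`, `L + |T₁| ≤ a`, `1 ≤ a`, and `a^ρ E(H; Q_a(0)) ≤ c`, then `L · ∫_{B_{a/2}} ‖G₀‖² ≤ c a^{1−ρ}`. [folklore] -/
theorem window_mul_le_of_gaugeE_rigid
    (hH : HasWeakSpatialGradientOn (slab (EuclideanSpace ℝ (Fin 3)) (Iio 0) isOpen_Iio) u H) (hT₁ : T₁ ≤ 0)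
    {G₀ : EuclideanSpace ℝ (Fin 3) → EuclideanSpace ℝ (Fin 3) →L[ℝ] EuclideanSpace ℝ (Fin 3)}
    (hrep : ∀ᵐ τ ∂(volume.restrict (Iio T₁)), H τ =ᵐ[volume] fun y =>
        (R τ : EuclideanSpace ℝ (Fin 3) →L[ℝ] EuclideanSpace ℝ (Fin 3)).comp
          ((G₀ ((R τ).symm (y - ξ τ))).comp ((R τ).symm : EuclideanSpace ℝ (Fin 3) →L[ℝ] EuclideanSpace ℝ (Fin 3))))
    {L a : ℝ} (ha1 : 1 ≤ a) (hLa : L + |T₁| ≤ a) (hξ : ∀ τ : ℝ, T₁ - L < τ → τ < T₁ → ‖ξ τ‖ ≤ a / 2)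
    {ρ : ℝ} {c : ℝ≥0} (hE : ENNReal.ofReal (a ^ ρ) * cknE a (0 : ℝ × EuclideanSpace ℝ (Fin 3)) H ≤ (c : ℝ≥0∞)) :
    ENNReal.ofReal L * ∫⁻ y in ball (0 : EuclideanSpace ℝ (Fin 3)) (a / 2), ENNReal.ofReal (‖G₀ y‖ ^ 2) ≤
      ENNReal.ofReal ((c : ℝ) * a ^ (1 - ρ)) := by
  have ha0 : 0 < a := by linarith
  set f : ℝ × EuclideanSpace ℝ (Fin 3) → ℝ≥0∞ := fun z => ENNReal.ofReal (frobeniusNormSq (H z.1 z.2)) with hf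
  set I : ℝ≥0∞ := ∫⁻ y in ball (0 : EuclideanSpace ℝ (Fin 3)) (a / 2), ENNReal.ofReal (‖G₀ y‖ ^ 2) with hI
  have hwin : Ioo (T₁ - L) T₁ ×ˢ ball (0 : EuclideanSpace ℝ (Fin 3)) a ⊆ Ioo (-(a ^ 2)) 0 ×ˢ ball (0 : EuclideanSpace ℝ (Fin 3)) a := by
    refine Set.prod_mono (fun τ hτ => ⟨?_, lt_of_lt_of_le hτ.2 hT₁⟩) Subset.rfl
    have h1 : a ≤ a ^ 2 := by nlinarith
    linarith [hτ.1, neg_abs_le T₁]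
  have hgauge := TimePeriodic.setLIntegral_window_le_of_gaugeE (H := H) (T := a ^ 2) ha0 le_rfl le_rfl hE
  refine le_trans ?_ ((lintegral_mono_set hwin).trans hgauge)
  have hmeas : AEMeasurable f ((volume.restrict (Ioo (T₁ - L) T₁)).prod (volume.restrict (ball (0 : EuclideanSpace ℝ (Fin 3)) a))) := by
    have h1 : AEStronglyMeasurable (uncurry H) (volume.restrict (Ioo (T₁ - L) T₁ ×ˢ ball (0 : EuclideanSpace ℝ (Fin 3)) a)) := by
      have h0 := hH.locallyIntegrableOn_grad.aestronglyMeasurable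
      rw [coe_slab] at h0
      exact h0.mono_set (Set.prod_mono (fun τ hτ => lt_of_lt_of_le hτ.2 hT₁) (subset_univ _))
    rw [Measure.volume_eq_prod, ← Measure.prod_restrict] at h1
    exact ((ENNReal.continuous_ofReal.comp LerayHopfProofs.continuous_frobeniusNormSq).comp_aestronglyMeasurable h1).aemeasurable
  rw [Measure.volume_eq_prod, ← Measure.prod_restrict, lintegral_prod _ hmeas]
  have hslice : ∀ᵐ τ ∂(volume.restrict (Ioo (T₁ - L) T₁)), I ≤ ∫⁻ y in ball (0 : EuclideanSpace ℝ (Fin 3)) a, f (τ, y) := by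
    filter_upwards [ae_restrict_of_ae_restrict_of_subset (fun τ hτ => hτ.2 : Ioo (T₁ - L) T₁ ⊆ Iio T₁) hrep,
      ae_restrict_mem measurableSet_Ioo] with τ hτ hτI
    -- rotate the half ball, then translate it inside `B_a`
    have e : I = ∫⁻ y in ball (0 : EuclideanSpace ℝ (Fin 3)) (a / 2), ENNReal.ofReal (‖G₀ ((R τ).symm y)‖ ^ 2) := by
      rw [hI, RotatingFrame.setLIntegral_ball_comp_isometry (R τ).symm (fun y => ENNReal.ofReal (‖G₀ y‖ ^ 2)) (a / 2)]
    rw [e]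
    refine (FrameSteady.setLIntegral_ball_half_le_translate (fun y => ENNReal.ofReal (‖G₀ ((R τ).symm y)‖ ^ 2))
      (hξ τ hτI.1 hτI.2)).trans ?_
    refine lintegral_mono_ae (ae_restrict_of_ae ?_)
    filter_upwards [hτ] with y hy
    simp only [hf, hy]
    refine ENNReal.ofReal_le_ofReal ?_
    have h1 := RotatingFrame.opNorm_le_opNorm_conj (R τ) (G₀ ((R τ).symm (y - ξ τ)))
    have h2 := sq_opNorm_le_frobeniusNormSq
      ((R τ : EuclideanSpace ℝ (Fin 3) →L[ℝ] EuclideanSpace ℝ (Fin 3)).comp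
        ((G₀ ((R τ).symm (y - ξ τ))).comp ((R τ).symm : EuclideanSpace ℝ (Fin 3) →L[ℝ] EuclideanSpace ℝ (Fin 3))))
    exact le_trans (by gcongr) h2
  calc ENNReal.ofReal L * I = ∫⁻ _ in Ioo (T₁ - L) T₁, I := by
        rw [lintegral_const, Measure.restrict_apply_univ, Real.volume_Ioo, show T₁ - (T₁ - L) = L by ring, mul_comm]
    _ ≤ ∫⁻ τ in Ioo (T₁ - L) T₁, ∫⁻ y in ball (0 : EuclideanSpace ℝ (Fin 3)) a, f (τ, y) := lintegral_mono_ae hslice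

/-- **THE PROFILE GRADIENT VANISHES under sub-critical escape** (`0 < ρ < 1`, `‖ξ(τ)‖ ≤ K(1+|τ|)^β` for `τ < T₁`, `β(1−ρ) < 1`): for every `Rb`,
`∫_{B_Rb} ‖G₀‖² = 0` (F1c's windows verbatim). [folklore] -/
theorem setLIntegral_profileGradient_rigid_eq_zero
    (hH : HasWeakSpatialGradientOn (slab (EuclideanSpace ℝ (Fin 3)) (Iio 0) isOpen_Iio) u H) (hT₁ : T₁ ≤ 0)
    {G₀ : EuclideanSpace ℝ (Fin 3) → EuclideanSpace ℝ (Fin 3) →L[ℝ] EuclideanSpace ℝ (Fin 3)}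
    (hrep : ∀ᵐ τ ∂(volume.restrict (Iio T₁)), H τ =ᵐ[volume] fun y =>
        (R τ : EuclideanSpace ℝ (Fin 3) →L[ℝ] EuclideanSpace ℝ (Fin 3)).comp
          ((G₀ ((R τ).symm (y - ξ τ))).comp ((R τ).symm : EuclideanSpace ℝ (Fin 3) →L[ℝ] EuclideanSpace ℝ (Fin 3))))
    {ρ : ℝ} (hρ : 0 < ρ) (hρ1 : ρ < 1) {c : ℝ≥0}
    (hE : ∀ a : ℝ, 0 < a → ENNReal.ofReal (a ^ ρ) * cknE a (0 : ℝ × EuclideanSpace ℝ (Fin 3)) H ≤ (c : ℝ≥0∞))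
    {K β : ℝ} (hK : 0 ≤ K) (hβρ : β * (1 - ρ) < 1) (hξ : ∀ τ : ℝ, τ < T₁ → ‖ξ τ‖ ≤ K * (1 + |τ|) ^ β) (Rb : ℝ) :
    ∫⁻ y in ball (0 : EuclideanSpace ℝ (Fin 3)) Rb, ENNReal.ofReal (‖G₀ y‖ ^ 2) = 0 := by
  set g : EuclideanSpace ℝ (Fin 3) → ℝ≥0∞ := fun y => ENNReal.ofReal (‖G₀ y‖ ^ 2) with hg
  set β' : ℝ := max β 1 with hβ'
  have hβ'1 : 1 ≤ β' := le_max_right _ _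
  have hβ'ρ : β' * (1 - ρ) < 1 := by
    rcases le_total β 1 with h | h
    · rw [hβ', max_eq_right h]; linarith
    · rw [hβ', max_eq_left h]; exact hβρ
  have hξ' : ∀ τ : ℝ, τ < T₁ → ‖ξ τ‖ ≤ K * (1 + |τ|) ^ β' := fun τ hτ =>
    (hξ τ hτ).trans (mul_le_mul_of_nonneg_left (Real.rpow_le_rpow_of_exponent_le (by linarith [abs_nonneg τ]) (le_max_left _ _)) hK)
  set C₀ : ℝ := 1 + |T₁| with hC₀
  have hC₀1 : 1 ≤ C₀ := by rw [hC₀]; linarith [abs_nonneg T₁]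
  have key : ∀ L : ℝ, 1 ≤ L → 2 * Rb ≤ L →
      ∫⁻ y in ball (0 : EuclideanSpace ℝ (Fin 3)) Rb, g y ≤
        ENNReal.ofReal ((c : ℝ) * (2 * K + 1) ^ (1 - ρ) * ((L + C₀) ^ (β' * (1 - ρ)) / L)) := by
    intro L hL1 hLR
    have hL : 0 < L := by linarith
    set Λ : ℝ := L + C₀ with hΛ
    have hΛ1 : 1 ≤ Λ := by rw [hΛ]; linarith
    have hΛ0 : 0 < Λ := by linarith
    set a : ℝ := (2 * K + 1) * Λ ^ β' with ha
    have hΛβ : Λ ≤ Λ ^ β' := by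
      have := Real.rpow_le_rpow_of_exponent_le hΛ1 hβ'1
      rwa [Real.rpow_one] at this
    have h2K : 1 ≤ 2 * K + 1 := by linarith
    have haΛ : Λ ^ β' ≤ a := by rw [ha]; exact le_mul_of_one_le_left (by positivity) h2K
    have ha1 : 1 ≤ a := hΛ1.trans (hΛβ.trans haΛ)
    have ha0 : 0 < a := by linarith
    have hLa : L + |T₁| ≤ a := by
      have : L + |T₁| ≤ Λ := by rw [hΛ, hC₀]; linarith
      exact this.trans (hΛβ.trans haΛ)
    have hfr : ∀ τ : ℝ, T₁ - L < τ → τ < T₁ → ‖ξ τ‖ ≤ a / 2 := by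
      intro τ h1 h2
      have hτ : 1 + |τ| ≤ Λ := by
        rw [hΛ, hC₀]
        have : |τ| ≤ |T₁| + L := by
          rw [abs_le]; constructor <;> linarith [le_abs_self T₁, neg_abs_le T₁]
        linarith
      have h3 : (1 + |τ|) ^ β' ≤ Λ ^ β' := Real.rpow_le_rpow (by linarith [abs_nonneg τ]) hτ (by linarith)
      calc ‖ξ τ‖ ≤ K * (1 + |τ|) ^ β' := hξ' τ h2
        _ ≤ K * Λ ^ β' := mul_le_mul_of_nonneg_left h3 hK
        _ ≤ a / 2 := by rw [ha]; nlinarith [Real.rpow_nonneg hΛ0.le β']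
    have hpack := window_mul_le_of_gaugeE_rigid hH hT₁ hrep ha1 hLa hfr (hE a ha0)
    have hRa : Rb ≤ a / 2 := by
      have : L ≤ a := le_trans (by linarith [abs_nonneg T₁]) hLa
      linarith
    have h1 : ENNReal.ofReal L * ∫⁻ y in ball (0 : EuclideanSpace ℝ (Fin 3)) Rb, g y ≤ ENNReal.ofReal ((c : ℝ) * a ^ (1 - ρ)) :=
      le_trans (mul_le_mul' le_rfl (lintegral_mono_set (ball_subset_ball hRa))) hpack
    have hL0' : ENNReal.ofReal L ≠ 0 := (ENNReal.ofReal_pos.2 hL).ne'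
    have h2 : ∫⁻ y in ball (0 : EuclideanSpace ℝ (Fin 3)) Rb, g y ≤ ENNReal.ofReal ((c : ℝ) * a ^ (1 - ρ)) / ENNReal.ofReal L := by
      rw [ENNReal.le_div_iff_mul_le (Or.inl hL0') (Or.inl ENNReal.ofReal_ne_top), mul_comm]; exact h1
    refine h2.trans ?_
    rw [← ENNReal.ofReal_div_of_pos hL]
    refine ENNReal.ofReal_le_ofReal ?_
    rw [ha, Real.mul_rpow (by linarith) (Real.rpow_nonneg hΛ0.le _), ← Real.rpow_mul hΛ0.le]
    exact le_of_eq (by ring)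
  have hlim : Tendsto (fun n : ℕ => ENNReal.ofReal ((c : ℝ) * (2 * K + 1) ^ (1 - ρ) * ((((n : ℝ)) + C₀) ^ (β' * (1 - ρ)) / (n : ℝ))))
      atTop (𝓝 0) := by
    set γ : ℝ := β' * (1 - ρ) with hγ
    have hγ1 : γ < 1 := hβ'ρ
    have h0 : Tendsto (fun n : ℕ => (2 : ℝ) ^ γ * (n : ℝ) ^ (γ - 1)) atTop (𝓝 0) := by
      have h1 : Tendsto (fun n : ℕ => ((n : ℝ)) ^ (γ - 1)) atTop (𝓝 0) := by
        have := (tendsto_rpow_neg_atTop (by linarith : 0 < 1 - γ)).comp tendsto_natCast_atTop_atTop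
        refine this.congr fun n => ?_
        simp only [Function.comp, neg_sub]
      have h2 := h1.const_mul ((2 : ℝ) ^ γ)
      rwa [mul_zero] at h2
    have hbd : ∀ᶠ n : ℕ in atTop, ((n : ℝ) + C₀) ^ γ / (n : ℝ) ≤ (2 : ℝ) ^ γ * (n : ℝ) ^ (γ - 1) := by
      filter_upwards [eventually_ge_atTop (Nat.ceil C₀)] with n hn
      have hnC : C₀ ≤ n := (Nat.le_ceil C₀).trans (by exact_mod_cast hn)
      have hn0 : (0 : ℝ) < n := by linarith
      have hγ0 : 0 ≤ γ := by rw [hγ]; exact mul_nonneg (by linarith) (by linarith)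
      have h1 : ((n : ℝ) + C₀) ^ γ ≤ (2 * (n : ℝ)) ^ γ := Real.rpow_le_rpow (by linarith) (by linarith) hγ0
      rw [div_le_iff₀ hn0]
      calc ((n : ℝ) + C₀) ^ γ ≤ (2 * (n : ℝ)) ^ γ := h1
        _ = (2 : ℝ) ^ γ * (n : ℝ) ^ (γ - 1) * n := by
          rw [Real.mul_rpow (by norm_num) hn0.le, Real.rpow_sub_one hn0.ne', mul_assoc, div_mul_cancel₀ _ hn0.ne']
    have hnn : ∀ᶠ n : ℕ in atTop, 0 ≤ ((n : ℝ) + C₀) ^ γ / (n : ℝ) :=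
      Eventually.of_forall fun n => div_nonneg (Real.rpow_nonneg (add_nonneg n.cast_nonneg (by linarith)) _) n.cast_nonneg
    have h3 : Tendsto (fun n : ℕ => ((n : ℝ) + C₀) ^ γ / (n : ℝ)) atTop (𝓝 0) :=
      tendsto_of_tendsto_of_tendsto_of_le_of_le' tendsto_const_nhds h0 hnn hbd
    have h4 := h3.const_mul ((c : ℝ) * (2 * K + 1) ^ (1 - ρ))
    rw [mul_zero] at h4
    have h5 := ENNReal.tendsto_ofReal h4
    rwa [ENNReal.ofReal_zero] at h5
  have key' : ∀ᶠ n : ℕ in atTop, ∫⁻ y in ball (0 : EuclideanSpace ℝ (Fin 3)) Rb, g y ≤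
      ENNReal.ofReal ((c : ℝ) * (2 * K + 1) ^ (1 - ρ) * ((((n : ℝ)) + C₀) ^ (β' * (1 - ρ)) / (n : ℝ))) := by
    filter_upwards [eventually_ge_atTop (max 1 (Nat.ceil (2 * Rb)))] with n hn
    have hn1 : (1 : ℝ) ≤ n := by exact_mod_cast (le_max_left _ _).trans hn
    have hnR : 2 * Rb ≤ n := (Nat.le_ceil (2 * Rb)).trans (by exact_mod_cast (le_max_right _ _).trans hn)
    exact key n hn1 hnR
  exact le_antisymm (le_of_tendsto_of_tendsto tendsto_const_nhds hlim key') bot_le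

/-! ## (3) The stratum -/

/-- **RIGID-FRAME-STEADY PAST MEMBERS WITH A SUB-CRITICALLY CONFINED CENTRE ARE TRIVIAL** (`0 < ρ < 1`).  Let `(u, p)` be a suitable weak Euler pair
on `(−∞,0) × ℝ³` with weak spatial gradient `H` in Seregin's class `a^{2ρ}A(a) + a^{ρ}E(a) + a^{2ρ}D(a) ≤ c` (all `a > 0`); suppose
`u(τ, ·) = R(τ) U(R(τ)⁻¹(· − ξ(τ))) + η(τ)` for all `τ < T₁ ≤ 0` with an arbitrary profile `U`, an arbitrary path `R` of linear isometries of `ℝ³`, a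
background `η` and a centre path with `‖ξ(τ)‖ ≤ K(1 + |τ|)^β`, `β(1 − ρ) < 1`.  Then `u = 0` a.e. on the slab.  (`R ≡ id`: F1c; `ξ ≡ 0`: F1-rot.)
[folklore] -/
theorem ae_eq_zero_of_gauge_of_pastRigidFrameSteady_confined {ρ : ℝ} (hρ : 0 < ρ) (hρ1 : ρ < 1)
    {p : ℝ → EuclideanSpace ℝ (Fin 3) → ℝ} {c : ℝ≥0}
    (hsw : IsSuitableWeakSolutionOn (slab (EuclideanSpace ℝ (Fin 3)) (Iio 0) isOpen_Iio) 0 0 u p)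
    (hH : HasWeakSpatialGradientOn (slab (EuclideanSpace ℝ (Fin 3)) (Iio 0) isOpen_Iio) u H)
    (hc : ∀ a : ℝ, 0 < a → ENNReal.ofReal (a ^ (2 * ρ)) * cknA a (0 : ℝ × EuclideanSpace ℝ (Fin 3)) u +
        ENNReal.ofReal (a ^ ρ) * cknE a (0 : ℝ × EuclideanSpace ℝ (Fin 3)) H +
        ENNReal.ofReal (a ^ (2 * ρ)) * cknD a (0 : ℝ × EuclideanSpace ℝ (Fin 3)) p ≤ (c : ℝ≥0∞))
    (hT₁ : T₁ ≤ 0) (hu : ∀ τ : ℝ, τ < T₁ → u τ = fun y => R τ (U ((R τ).symm (y - ξ τ))) + η τ)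
    {K β : ℝ} (hK : 0 ≤ K) (hβρ : β * (1 - ρ) < 1) (hξ : ∀ τ : ℝ, τ < T₁ → ‖ξ τ‖ ≤ K * (1 + |τ|) ^ β) :
    uncurry u =ᵐ[volume.restrict (Iio (0 : ℝ) ×ˢ (univ : Set (EuclideanSpace ℝ (Fin 3))))] 0 := by
  have hE : ∀ a : ℝ, 0 < a → ENNReal.ofReal (a ^ ρ) * cknE a (0 : ℝ × EuclideanSpace ℝ (Fin 3)) H ≤ (c : ℝ≥0∞) :=
    fun a ha => le_trans (le_trans le_add_self le_self_add) (hc a ha)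
  have hA : ∀ a : ℝ, 0 < a → ENNReal.ofReal (a ^ (2 * ρ)) * cknA a (0 : ℝ × EuclideanSpace ℝ (Fin 3)) u ≤ (c : ℝ≥0∞) :=
    fun a ha => le_trans (le_trans le_self_add le_self_add) (hc a ha)
  obtain ⟨G₀, hG₀m, hrep⟩ := exists_profileGradient_rigid hH hT₁ hu
  have hG0 : G₀ =ᵐ[volume] 0 := by
    have hball : ∀ n : ℕ, ∀ᵐ y ∂(volume.restrict (ball (0 : EuclideanSpace ℝ (Fin 3)) (n : ℝ))), G₀ y = 0 := by
      intro n
      have hm : AEMeasurable (fun y => ENNReal.ofReal (‖G₀ y‖ ^ 2)) (volume.restrict (ball (0 : EuclideanSpace ℝ (Fin 3)) (n : ℝ))) :=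
        (ENNReal.measurable_ofReal.comp_aemeasurable ((hG₀m.norm.aemeasurable.pow_const 2))).restrict
      have h0 := (lintegral_eq_zero_iff' hm).1
        (setLIntegral_profileGradient_rigid_eq_zero hH hT₁ hrep hρ hρ1 hE hK hβρ hξ n)
      filter_upwards [h0] with y hy
      have h1 : ‖G₀ y‖ ^ 2 ≤ 0 := ENNReal.ofReal_eq_zero.1 hy
      exact norm_eq_zero.1 (by nlinarith [norm_nonneg (G₀ y)])
    have hU : (univ : Set (EuclideanSpace ℝ (Fin 3))) = ⋃ n : ℕ, ball (0 : EuclideanSpace ℝ (Fin 3)) (n : ℝ) := by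
      ext y; simp only [mem_univ, mem_iUnion, mem_ball_zero_iff, true_iff]; exact exists_nat_gt ‖y‖
    have := (ae_restrict_iUnion_iff (μ := (volume : Measure (EuclideanSpace ℝ (Fin 3)))) (s := fun n : ℕ => ball 0 (n : ℝ))
      (p := fun y => G₀ y = 0)).2 hball
    rwa [← hU, Measure.restrict_univ] at this
  have hslice0 : ∀ᵐ τ ∂(volume.restrict (Iio T₁)), H τ =ᵐ[volume] 0 := by
    filter_upwards [hrep] with τ hτ
    have h1 := ((R τ).symm.measurePreserving.comp (measurePreserving_sub_right volume (ξ τ))).quasiMeasurePreserving.ae_eq hG0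
    refine hτ.trans ?_
    filter_upwards [h1] with y hy
    simp only [Function.comp_apply, Pi.zero_apply] at hy
    simp only [hy, ContinuousLinearMap.zero_comp, ContinuousLinearMap.comp_zero, Pi.zero_apply]
  have hHm : AEStronglyMeasurable (uncurry H) (volume.restrict (Iio T₁ ×ˢ (univ : Set (EuclideanSpace ℝ (Fin 3))))) := by
    have h0 := hH.locallyIntegrableOn_grad.aestronglyMeasurable
    rw [coe_slab] at h0
    exact h0.mono_set (Set.prod_mono (Iio_subset_Iio hT₁) Subset.rfl)
  have hH0 := FrameSteady.ae_zero_of_ae_slice hHm hslice0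
  have hslice := TypeIliouvilleNoTypeII.PowerGaugeSteady.ae_slice_const_of_weakGradient_ae_zero isOpen_Iio
    (hH.mono (slab_mono (Iio_subset_Iio hT₁))) hH0
  have hzero : ∀ᵐ τ ∂(volume.restrict (Iio T₁)), ∫⁻ x, ‖u τ x‖ₑ ^ 2 = 0 := by
    filter_upwards [hslice, ae_restrict_mem measurableSet_Iio] with τ hτ hτT
    obtain ⟨b, hb⟩ := hτ
    exact PastPeriodic.lintegral_slice_eq_zero_of_ae_const_of_gaugeA hρ hA (lt_of_lt_of_le hτT hT₁) hb
  exact PastSymmetric.ae_eq_zero_of_gauge_of_pastSlicesZero hρ.le hsw hH hc hzero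

end RigidFrame

end Summit.NavierStokesRegularity.NavierStokesRegularity.Theorems.PowerGaugeEulerLiouville

end
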